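import Summits.BirchSwinnertonDyer.Rank1Residual.X11b.HalvesReceptacle
import Literature.NumberTheory.EllipticCurves.UnrIntegersSqrtNegOne
import Mathlib.NumberTheory.Padics.Hensel
import HarnessLib

set_option linter.dupNamespace false
set_option autoImplicit false

/-! # `√u ∈ R₀ = unrIntegers 3` for every integer `u` prime to `3` — the display constant
`√D_K` of the BDP frame lies in the receptacle at `p = 3` for EVERY Heegner field with `3` split

Cell `bsd-cn100`, prover seat `bsd-cn100-s2b-c3` (g5). Supports, does not close,
stmt-BirchSwinnertonDyer-19160 (line `three-adic-bdp-triple` v5cp; twin 19159 v6bp). The cell's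
normalisation audit (MEMO-transfer-12 §6 / Addendum A.4, 2026-08-26) found that the refereed
interpolation constant omitted by Castella's display carries `√D_K` (`D_K = −d_K` the discriminant of
the Heegner field `K`); the EXACT S2b statements `ThreeAdicBDPElementExists/…` ask for `𝓛 ∈ R₀⟦T⟧`,
`R₀ = unrIntegers 3`, so they are unit-exact iff `√D_K ∈ R₀`. On the S2b lines `3` SPLITS in `K`, i.e.
`3 ∤ D_K`. This file proves the positive fact in full generality at `p = 3`:

* `exists_padicInt_sq_eq_of_three_dvd_sub_one` — Hensel: an integer `u ≡ 1 (mod 3)` is a square in `ℤ₃`;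
* `exists_sq_eq_intCast_mem_unrIntegers_three` — **every integer `u` with `3 ∤ u` is a square in
  `R₀ = unrIntegers 3`** (`u ≡ 1`: `√u ∈ ℤ₃ ⊂ R₀`; `u ≡ 2`: `√u = √−1 · √(−u)` with `√−1 ∈ R₀`, the
  tree's `exists_sq_eq_neg_one_mem_unrIntegers`, transfer g9).

So at `p = 3` the constant `√D_K` is absorbable into `R₀` for every admissible `K` (contrast `p = 2`:
`MordellShaFreeCutUnrIntegersSqrtNegOne.sq_ne_neg_one_of_mem_fracUnr_two`). HONEST FRAMING: elementary
`3`-adic algebra about the receptacle; nothing about any `L`-function, crux A/B, the leaf, Sylvester's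
conjecture or BSD is proved. PARTITION: none — RANK axis.

[cite: Castella2018, §3 (p. 9) (the ring R₀)] [cite: SerreLocalFields1979, Ch. II §4 and Ch. IV §4]
-/

noncomputable section

open scoped Classical

namespace Summit.BirchSwinnertonDyer.BirchSwinnertonDyer.Theorems.MordellShaFreeCutUnrIntegersThreeSqrt

open Polynomial Literature.NumberTheory.EllipticCurves
open Summit.BirchSwinnertonDyer.Rank1Residual.X11b

/-- **Hensel at `3`: an integer `u ≡ 1 (mod 3)` is a square in `ℤ₃`** (`F = X² − u`, `a = 1`:
`‖F(1)‖ = ‖1 − u‖ < 1 = ‖F′(1)‖² = ‖2‖²`). [folklore] [cite: SerreLocalFields1979, Ch. II §4] -/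
theorem exists_padicInt_sq_eq_of_three_dvd_sub_one (u : ℤ) (hu : (3 : ℤ) ∣ u - 1) :
    ∃ z : ℤ_[3], z ^ 2 = (u : ℤ_[3]) := by
  set F : Polynomial ℤ := X ^ 2 - C u with hF
  have hFa : F.aeval (1 : ℤ_[3]) = 1 - (u : ℤ_[3]) := by
    simp [hF, map_sub, aeval_X_pow]
  have hF' : F.derivative = C (2 : ℤ) * X := by
    rw [hF, derivative_sub, derivative_X_pow, derivative_C, sub_zero]
    norm_num
  have hFda : F.derivative.aeval (1 : ℤ_[3]) = 2 := by
    rw [hF', map_mul, aeval_C, aeval_X, mul_one, map_ofNat]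
  have h2 : ‖(2 : ℤ_[3])‖ = 1 := by
    have hle : ‖((2 : ℤ) : ℤ_[3])‖ ≤ 1 := PadicInt.norm_le_one _
    have hlt : ¬ ‖((2 : ℤ) : ℤ_[3])‖ < 1 := by
      rw [PadicInt.norm_int_lt_one_iff_dvd]; decide
    push_cast at hle hlt
    exact le_antisymm hle (not_lt.mp hlt)
  have hnorm : ‖F.aeval (1 : ℤ_[3])‖ < ‖F.derivative.aeval (1 : ℤ_[3])‖ ^ 2 := by
    rw [hFa, hFda, h2, one_pow]
    have : ‖((1 - u : ℤ) : ℤ_[3])‖ < 1 := by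
      rw [PadicInt.norm_int_lt_one_iff_dvd]
      have : (3 : ℤ) ∣ -(u - 1) := (dvd_neg).mpr hu
      simpa [neg_sub] using this
    simpa using this
  obtain ⟨z, hz, -, -, -⟩ := hensels_lemma hnorm
  refine ⟨z, ?_⟩
  have : F.aeval z = z ^ 2 - (u : ℤ_[3]) := by simp [hF, map_sub, aeval_X_pow]
  rw [this] at hz
  exact sub_eq_zero.mp hz

/-- **Every integer prime to `3` is a square in `R₀ = unrIntegers 3`** (`= W(𝔽̄₃)`): for
`u ≡ 1 (mod 3)` a square root lies already in `ℤ₃ ⊂ R₀` (Hensel, `algebraMap_coe_padicInt_mem_unrIntegers`);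
for `u ≡ 2 (mod 3)`, `√u = √−1 · √(−u)` with `√−1 ∈ R₀` (`exists_sq_eq_neg_one_mem_unrIntegers`, odd `p`).
In particular `√D_K ∈ R₀` for every imaginary quadratic `K` in which `3` splits (`3 ∤ D_K`) — the
receptacle-level reason the EXACT S2b display is unit-exact at `3` (MEMO-transfer-12 §6/A.4). [folklore]
[cite: SerreLocalFields1979, Ch. IV §4 (units of the maximal unramified extension)] -/
theorem exists_sq_eq_intCast_mem_unrIntegers_three (u : ℤ) (hu : ¬ (3 : ℤ) ∣ u) :
    ∃ r ∈ unrIntegers 3, r ^ 2 = (u : ℂ_[3]) := by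
  -- from a square root in `ℤ₃` to one in `R₀`
  have lift : ∀ v : ℤ, (3 : ℤ) ∣ v - 1 → ∃ s ∈ unrIntegers 3, s ^ 2 = (v : ℂ_[3]) := by
    intro v hv
    obtain ⟨z, hz⟩ := exists_padicInt_sq_eq_of_three_dvd_sub_one v hv
    refine ⟨algebraMap ℚ_[3] ℂ_[3] (z : ℚ_[3]), Halves.algebraMap_coe_padicInt_mem_unrIntegers 3 z, ?_⟩
    rw [← map_pow, ← PadicInt.coe_pow, hz, PadicInt.coe_intCast, map_intCast]
  -- `u mod 3 ∈ {1, 2}`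
  have hcases : (3 : ℤ) ∣ u - 1 ∨ (3 : ℤ) ∣ -u - 1 := by
    rcases Int.emod_emod_of_dvd u (dvd_refl (3 : ℤ)) with -
    have h0 : u % 3 ≠ 0 := fun h ↦ hu (Int.dvd_of_emod_eq_zero h)
    have hlt : u % 3 < 3 := Int.emod_lt_of_pos u (by norm_num)
    have hge : 0 ≤ u % 3 := Int.emod_nonneg u (by norm_num)
    have h12 : u % 3 = 1 ∨ u % 3 = 2 := by omega
    rcases h12 with h | h
    · left; exact Int.ModEq.dvd (show (1 : ℤ) ≡ u [ZMOD 3] from by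
        rw [Int.ModEq]; simp [h])
    · right
      have : (3 : ℤ) ∣ u - 2 := Int.ModEq.dvd (show (2 : ℤ) ≡ u [ZMOD 3] from by rw [Int.ModEq]; simp [h])
      have e : -u - 1 = -(u - 2) - 3 := by ring
      rw [e]; exact dvd_sub ((dvd_neg).mpr this) (dvd_refl 3)
  rcases hcases with h1 | h2
  · exact lift u h1
  · -- `u ≡ 2`: `√u = √−1 · √(−u)`
    obtain ⟨s, hs, hs2⟩ := lift (-u) h2
    obtain ⟨i, hi, hi2⟩ := exists_sq_eq_neg_one_mem_unrIntegers (p := 3) (by norm_num)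
    refine ⟨i * s, mul_mem hi hs, ?_⟩
    rw [mul_pow, hi2, hs2]; push_cast; ring

/-- The `Frac R₀` form: every integer prime to `3` is a square in `Frac(unrIntegers 3) = Subfield.closure R₀`
(contrast `p = 2`, where `−1` is not: `MordellShaFreeCutUnrIntegersSqrtNegOne.sq_ne_neg_one_of_mem_fracUnr_two`).
[folklore] [cite: SerreLocalFields1979, Ch. IV §4] -/
theorem exists_sq_eq_intCast_mem_fracUnr_three (u : ℤ) (hu : ¬ (3 : ℤ) ∣ u) :
    ∃ r ∈ Subfield.closure (unrIntegers 3 : Set ℂ_[3]), r ^ 2 = (u : ℂ_[3]) := by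
  obtain ⟨r, hr, hr2⟩ := exists_sq_eq_intCast_mem_unrIntegers_three u hu
  exact ⟨r, Subfield.subset_closure hr, hr2⟩

end Summit.BirchSwinnertonDyer.BirchSwinnertonDyer.Theorems.MordellShaFreeCutUnrIntegersThreeSqrt

end
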